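import Literature.AlgebraicGeometry.Resolution.NormalizationInExtension
import HarnessLib

/-!
# Crux `Picover` (stmt-ResolutionOfSingularities-0554): the affine charts of `W^L → W`

Route `ResolutionOfSingularities/pAlteration`, crux `Picover`, support file (line lead a2, 2026-08-16),
companion of `PAlterationPicoverResolutionGluing.lean` (`Picover` ⟺ functorial local resolutions
of the pieces of `W^L = normalizationIn W L` over the affine opens of `W`). This file identifies
those pieces: over a non-empty affine open `U = Spec R ⊆ W`, the restriction
`normalizationInι W L ∣_ U : W^L ×_W U → U` is, as an arrow, `Spec` of the inclusion of `R` into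
its integral closure in `L` (`L` an `R`-algebra through `R → K(W) → L`) — the normalisation of
the rank-5 local model `Spec (R[T]/(T^p − a))~` when `L = K(W)(a^{1/p})`.

* `nonempty_chartArrowIso` — `Arrow.mk (normalizationInι W L ∣_ U) ≅ Arrow.mk (Spec (R̄ᴸ) → Spec R)`.

Mathlib's relative normalisation is glued from exactly these charts
(`Scheme.Hom.ι_fromNormalization`, `Scheme.Hom.fromNormalization_preimage`); the only extra input
is the tree's identification `Γ(Spec L, ξ_L⁻¹ U) ≅ L` over `Γ(W, U)` (`extensionIsoSections`,
`fromSpecExtension_app_apply`). No new definitions. [folklore; cite: StacksProject, Tag 035H]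
-/

noncomputable section

set_option linter.dupNamespace false -- mandated namespace of this single-conjunct summit

open CategoryTheory CategoryTheory.Limits AlgebraicGeometry TopologicalSpace
open Literature.AlgebraicGeometry.Resolution

namespace Summit.ResolutionOfSingularities.ResolutionOfSingularities.Theorems.Picover.ResolutionGluingCharts

/-- **The chart of `W^L → W` over a non-empty affine open `U ⊆ W`** is `Spec` of
`Γ(W, U) ↪ integralClosure Γ(W, U) L`, where `L` is a `Γ(W, U)`-algebra through
`Γ(W, U) → K(W) → L`: as arrows, `normalizationInι W L ∣_ U ≅ (Spec (Γ(W,U)̄ᴸ) → Spec Γ(W, U))`.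
(Mathlib glues the relative normalisation from the charts `Spec` of the integral closure of
`Γ(W, U)` in `Γ(Spec L, ξ_L⁻¹ U)`; the latter ring is `L` over `Γ(W, U)`.) Registered sub-goal of the
crux item (signature verbatim, universe `0`). [cite: StacksProject, Tag 035H] -/
theorem nonempty_chartArrowIso : ∀ (W : Scheme.{0}) [IsIntegral W] (L : Type) [Field L] [Algebra W.functionField L] (U : W.affineOpens) [Nonempty (U : W.Opens)], letI : Algebra Γ(W, U) L := ((algebraMap W.functionField L).comp (W.germToFunctionField U).hom).toAlgebra; Nonempty (Arrow.mk (normalizationInι W L ∣_ (U : W.Opens)) ≅ Arrow.mk (Spec.map (CommRingCat.ofHom (algebraMap Γ(W, U) (integralClosure Γ(W, U) L))))) := by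
  intro W _ L _ _ U hU
  -- the two `Γ(W, U)`-algebra structures
  letI algS : Algebra Γ(W, U) Γ(Spec (.of L), fromSpecExtension W L ⁻¹ᵁ U) :=
    (((fromSpecExtension W L).app U).hom).toAlgebra
  letI algL : Algebra Γ(W, U) L :=
    ((algebraMap W.functionField L).comp (W.germToFunctionField U).hom).toAlgebra
  have hU' : ((U : W.Opens) : Set W).Nonempty := by
    obtain ⟨x⟩ := hU
    exact ⟨x.1, x.2⟩
  -- `L ≃ₐ[Γ(W, U)] Γ(Spec L, ξ_L⁻¹ U)` and the induced isomorphism of integral closures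
  let e : L ≃ₐ[Γ(W, U)] Γ(Spec (.of L), fromSpecExtension W L ⁻¹ᵁ U) :=
    { (extensionIsoSections (X := W) (L := L) hU').commRingCatIsoToRingEquiv with
      commutes' := fun a => (fromSpecExtension_app_apply (X := W) (L := L) hU' a).symm }
  let ē : integralClosure Γ(W, U) L ≃ₐ[Γ(W, U)]
      integralClosure Γ(W, U) Γ(Spec (.of L), fromSpecExtension W L ⁻¹ᵁ U) :=
    e.mapIntegralClosure
  have hē : ∀ a, ē.symm (algebraMap Γ(W, U) _ a) =
      algebraMap Γ(W, U) (integralClosure Γ(W, U) L) a :=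
    fun a => ē.symm.commutes a
  -- the chart of Mathlib's relative normalisation over `U`, as an arrow (we work with
  -- `(fromSpecExtension W L).fromNormalization`, which is `normalizationInι W L` by definition)
  have hrange : Set.range ((fromSpecExtension W L).normalizationOpenCover.f U) =
      Set.range ((fromSpecExtension W L).fromNormalization ⁻¹ᵁ (U : W.Opens)).ι := by
    rw [Scheme.Opens.range_ι]
    exact congr_arg SetLike.coe ((fromSpecExtension W L).fromNormalization_preimage U).symm
  let e₁ := IsOpenImmersion.isoOfRangeEq ((fromSpecExtension W L).normalizationOpenCover.f U)
      ((fromSpecExtension W L).fromNormalization ⁻¹ᵁ (U : W.Opens)).ι hrange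
  have h1 : e₁.hom ≫ ((fromSpecExtension W L).fromNormalization ⁻¹ᵁ (U : W.Opens)).ι =
      (fromSpecExtension W L).normalizationOpenCover.f U :=
    IsOpenImmersion.isoOfRangeEq_hom_fac _ _ hrange
  let e₂ : Spec Γ(W, U) ≅ ↑(U : W.Opens) := U.2.isoSpec.symm
  have h2 : e₂.hom ≫ (U : W.Opens).ι = U.2.fromSpec := U.2.isoSpec_inv_ι
  have h3 : (fromSpecExtension W L).normalizationOpenCover.f U ≫
      (fromSpecExtension W L).fromNormalization =
      Spec.map ((fromSpecExtension W L).normalizationDiagramMap.app (.op U.1)) ≫ U.2.fromSpec :=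
    (fromSpecExtension W L).ι_fromNormalization U
  have h4 : ((fromSpecExtension W L).fromNormalization ∣_ (U : W.Opens)) ≫ (U : W.Opens).ι =
      ((fromSpecExtension W L).fromNormalization ⁻¹ᵁ (U : W.Opens)).ι ≫
        (fromSpecExtension W L).fromNormalization :=
    morphismRestrict_ι _ _
  have comm₁ : e₁.hom ≫ ((fromSpecExtension W L).fromNormalization ∣_ (U : W.Opens)) =
      Spec.map ((fromSpecExtension W L).normalizationDiagramMap.app (.op U.1)) ≫ e₂.hom := by
    rw [← cancel_mono (U : W.Opens).ι]
    calc (e₁.hom ≫ ((fromSpecExtension W L).fromNormalization ∣_ (U : W.Opens))) ≫ (U : W.Opens).ι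
        = e₁.hom ≫ (((fromSpecExtension W L).fromNormalization ∣_ (U : W.Opens)) ≫
            (U : W.Opens).ι) := Category.assoc _ _ _
      _ = e₁.hom ≫ (((fromSpecExtension W L).fromNormalization ⁻¹ᵁ (U : W.Opens)).ι ≫
            (fromSpecExtension W L).fromNormalization) := by rw [h4]
      _ = (e₁.hom ≫ ((fromSpecExtension W L).fromNormalization ⁻¹ᵁ (U : W.Opens)).ι) ≫
            (fromSpecExtension W L).fromNormalization := (Category.assoc _ _ _).symm
      _ = (fromSpecExtension W L).normalizationOpenCover.f U ≫
            (fromSpecExtension W L).fromNormalization := by rw [h1]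
      _ = Spec.map ((fromSpecExtension W L).normalizationDiagramMap.app (.op U.1)) ≫
            U.2.fromSpec := h3
      _ = Spec.map ((fromSpecExtension W L).normalizationDiagramMap.app (.op U.1)) ≫
            (e₂.hom ≫ (U : W.Opens).ι) := by rw [h2]
      _ = (Spec.map ((fromSpecExtension W L).normalizationDiagramMap.app (.op U.1)) ≫ e₂.hom) ≫
            (U : W.Opens).ι := (Category.assoc _ _ _).symm
  let A₁ : Arrow.mk (Spec.map ((fromSpecExtension W L).normalizationDiagramMap.app (.op U.1))) ≅
      Arrow.mk ((fromSpecExtension W L).fromNormalization ∣_ (U : W.Opens)) :=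
    Arrow.isoMk' _ _ e₁ e₂ comm₁
  -- replace `Γ(Spec L, ξ_L⁻¹ U)` by `L`
  let eI : CommRingCat.of (integralClosure Γ(W, U) Γ(Spec (.of L), fromSpecExtension W L ⁻¹ᵁ U)) ≅
      CommRingCat.of (integralClosure Γ(W, U) L) :=
    ē.symm.toRingEquiv.toCommRingCatIso
  have comm₂ : Spec.map eI.hom ≫
      Spec.map ((fromSpecExtension W L).normalizationDiagramMap.app (.op U.1)) =
      Spec.map (CommRingCat.ofHom (algebraMap Γ(W, U) (integralClosure Γ(W, U) L))) := by
    rw [← Spec.map_comp]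
    congr 1
    ext a
    exact congr_arg Subtype.val (hē a)
  let A₂ : Arrow.mk (Spec.map (CommRingCat.ofHom
        (algebraMap Γ(W, U) (integralClosure Γ(W, U) L)))) ≅
      Arrow.mk (Spec.map ((fromSpecExtension W L).normalizationDiagramMap.app (.op U.1))) :=
    Arrow.isoMk' _ _ (Scheme.Spec.mapIso eI.op) (Iso.refl _)
      (by rw [Iso.refl_hom, Category.comp_id]; exact comm₂)
  exact ⟨(A₂ ≪≫ A₁).symm⟩

end Summit.ResolutionOfSingularities.ResolutionOfSingularities.Theorems.Picover.ResolutionGluingCharts
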